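import Summits.AtomisticToContinuum.Crystallization.Theorems.TornFree.Negative.TolFamily

/-!
# Crux `GappedShellCensus.TornFree` (stmt-AtomisticToContinuum-18069) — the ONE-CENTRE glue,
# parametrically in the tolerance `τ` and the gap ratio `γ`

`TornFreeTol τ γ` (Negative/TolFamily.lean; the crux is the member `(1/50, 63/50)` by `Iff.rfl`)
follows from the purely ONE-CENTRE, twelve-point statement

> `MinDegFour τ γ`: every twelve-point set `T ⊂ ℝ³` with norms in `[1 − τ, 1 + τ]` and pairwise
> distances `≥ 1 − τ` and either `≤ 1 + τ` or `≥ γ` (a gapped twelve-shell, in the `Finset`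
> vocabulary of `ShellTrichotomy` / the census replayer `ShellCensusTwelve`) has every point with at
> least FOUR others within `1 + τ`,

because the rescaled shell `a⁻¹ • (shell(y) − y)` of a gapped-twelve site is such a set and the
shell-degree of `a⁻¹ • (v − y)` in it is the common-neighbour count of the bond `(y, v)`
(`tornFreeTol_of_minDegFour`, any real `τ`, `γ`; at the crux's constants compose with
`tornFree_iff_tornFreeTol.mpr`).

Status of the hypothesis (numbers, not a claim): at the crux's `(1/50, 63/50)` it is FALSE — torn
single shells exist (route repair record: the torn icosahedron; rfix seat kit j025129: 19 torn
classes with thresholds `τ ∈ [1.51 %, 2.00 %]`) — which is why line `Sketch` reduces the crux to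
MULTI-centre finite classes instead (Lines/Sketch.lean).  But the same scan finds the torn zoo EMPTY
at `τ ≤ 1.25 %` (gap `63/50`) and at gap ratio `1.34` (tolerance `2 %`): in those fallback regimes
`TornFreeTol` is a one-centre census theorem, and this file is its glue.  No new definitions
(`MinDegFour` is spelled out as the hypothesis); no named facts.
-/

noncomputable section

namespace Summit.AtomisticToContinuum.Crystallization.Theorems

open Summit.AtomisticToContinuum.Crystallization.Theorems.TornFree.Negative

/-- `Finset` bookkeeping: for an injective `f` and a finite set `S`, the number of points of the
image finset `(hS.toFinset).image f` satisfying `P'` is the `ncard` of the `P`-part of `S`, provided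
`P' (f w) ↔ P w` on `S`. -/
private theorem tfmd_card_filter_image {α β : Type*} [DecidableEq β] {f : α → β}
    (hf : Function.Injective f) {S : Set α} (hS : S.Finite) (P : α → Prop) (P' : β → Prop)
    [DecidablePred P'] (h : ∀ w ∈ S, (P' (f w) ↔ P w)) :
    ((hS.toFinset.image f).filter P').card = {w ∈ S | P w}.ncard := by
  classical
  have hset : (((hS.toFinset.image f).filter P' : Finset β) : Set β) = f '' {w ∈ S | P w} := by
    ext w'
    simp only [Finset.coe_filter, Finset.mem_image, Set.Finite.mem_toFinset, Set.mem_image,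
      Set.mem_setOf_eq]
    constructor
    · rintro ⟨⟨w, hw, rfl⟩, hP⟩
      exact ⟨w, ⟨hw, (h w hw).mp hP⟩, rfl⟩
    · rintro ⟨w, ⟨hw, hP⟩, rfl⟩
      exact ⟨⟨w, hw, rfl⟩, (h w hw).mpr hP⟩
  rw [← Set.ncard_coe_finset, hset, Set.ncard_image_of_injective _ hf]

/-- **One-centre glue (parametric).** If every gapped twelve-shell at tolerance `τ` and gap ratio
`γ` has minimum shell-degree `≥ 4`, then `TornFreeTol τ γ`: every bond of an all-gapped-twelve
configuration has `≥ 4` common neighbours.  (The shell of `y`, translated by `−y` and rescaled by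
`a⁻¹`, is a gapped twelve-shell; the shell-degree of the image of `v` is the common-neighbour count
of `(y, v)`.) -/
theorem tornFreeTol_of_minDegFour :
    ∀ (τ γ : ℝ), (∀ T : Finset (EuclideanSpace ℝ (Fin 3)), T.card = 12 →
      (∀ v ∈ T, 1 - τ ≤ ‖v‖ ∧ ‖v‖ ≤ 1 + τ) →
      (∀ v ∈ T, ∀ w ∈ T, v ≠ w → 1 - τ ≤ dist v w ∧ (dist v w ≤ 1 + τ ∨ γ ≤ dist v w)) →
      ∀ v ∈ T, 4 ≤ (T.filter fun w => w ≠ v ∧ dist v w ≤ 1 + τ).card) →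
    Summit.AtomisticToContinuum.Crystallization.Theorems.TornFree.Negative.TornFreeTol τ γ := by
  classical
  intro τ γ hmin Y a ha hall y hy v hv hvy hdv
  -- the shell of `y` and the similarity `f`
  set S : Set (EuclideanSpace ℝ (Fin 3)) := {w ∈ Y | w ≠ y ∧ dist y w ≤ a * (1 + τ)} with hSdef
  have hS12 : S.ncard = 12 := (hall y hy).1
  have hSfin : S.Finite := Set.finite_of_ncard_ne_zero (by rw [hS12]; norm_num)
  let f : EuclideanSpace ℝ (Fin 3) → EuclideanSpace ℝ (Fin 3) := fun w => a⁻¹ • (w - y)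
  have hd : ∀ p q, dist (f p) (f q) = a⁻¹ * dist p q := fun p q => by
    show dist (a⁻¹ • (p - y)) (a⁻¹ • (q - y)) = a⁻¹ * dist p q
    rw [dist_smul₀, dist_sub_right, Real.norm_eq_abs, abs_of_pos (inv_pos.2 ha)]
  have hfy : f y = 0 := by show a⁻¹ • (y - y) = (0 : EuclideanSpace ℝ (Fin 3)); rw [sub_self, smul_zero]
  have hf : Function.Injective f := fun p q h => by
    have h0 := hd p q
    rw [h, dist_self] at h0
    exact dist_eq_zero.mp ((mul_eq_zero.mp h0.symm).resolve_left (inv_ne_zero ha.ne'))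
  have hn : ∀ w, ‖f w‖ = a⁻¹ * dist y w := fun w => by
    rw [← dist_zero_right, ← hfy, hd, dist_comm]
  -- the rescaled shell as a twelve-point finset
  set T : Finset (EuclideanSpace ℝ (Fin 3)) := hSfin.toFinset.image f with hTdef
  have hT12 : T.card = 12 := by
    rw [hTdef, Finset.card_image_of_injective _ hf, ← Set.ncard_eq_toFinset_card S hSfin, hS12]
  have hmemT : ∀ {w' : EuclideanSpace ℝ (Fin 3)}, w' ∈ T ↔ ∃ w ∈ S, f w = w' := fun {w'} => by
    rw [hTdef, Finset.mem_image]
    simp only [Set.Finite.mem_toFinset]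
  -- admissibility of `T`
  have hnorm : ∀ w' ∈ T, 1 - τ ≤ ‖w'‖ ∧ ‖w'‖ ≤ 1 + τ := by
    intro w' hw'
    obtain ⟨w, hw, rfl⟩ := hmemT.mp hw'
    rw [hn, le_inv_mul_iff₀ ha, inv_mul_le_iff₀ ha]
    exact ⟨((hall y hy).2 w hw.1 hw.2.1).1, hw.2.2⟩
  have hpair : ∀ w' ∈ T, ∀ u' ∈ T, w' ≠ u' →
      1 - τ ≤ dist w' u' ∧ (dist w' u' ≤ 1 + τ ∨ γ ≤ dist w' u') := by
    intro w' hw' u' hu' hne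
    obtain ⟨w, hw, rfl⟩ := hmemT.mp hw'
    obtain ⟨u, hu, rfl⟩ := hmemT.mp hu'
    have hwu : u ≠ w := fun h => hne (by rw [h])
    rw [hd, le_inv_mul_iff₀ ha, inv_mul_le_iff₀ ha, le_inv_mul_iff₀ ha]
    exact (hall w hw.1).2 u hu.1 hwu
  -- `v` is a shell point; its shell-degree in `T` is the commons count of the bond
  have hvS : v ∈ S := ⟨hv, hvy, hdv⟩
  have hvT : f v ∈ T := hmemT.mpr ⟨v, hvS, rfl⟩
  have h4 := hmin T hT12 hnorm hpair (f v) hvT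
  have hcard : (T.filter fun w' => w' ≠ f v ∧ dist (f v) w' ≤ 1 + τ).card =
      {w ∈ S | w ≠ v ∧ dist v w ≤ a * (1 + τ)}.ncard := by
    rw [hTdef]
    exact tfmd_card_filter_image hf hSfin (fun w => w ≠ v ∧ dist v w ≤ a * (1 + τ))
      (fun w' => w' ≠ f v ∧ dist (f v) w' ≤ 1 + τ)
      (fun w _ => by rw [hf.ne_iff, hd, inv_mul_le_iff₀ ha])
  have hcom : {w ∈ S | w ≠ v ∧ dist v w ≤ a * (1 + τ)} = commons τ Y a y v := by
    ext w
    simp only [hSdef, commons, Set.mem_setOf_eq]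
    tauto
  rw [hcard, hcom] at h4
  exact h4

end Summit.AtomisticToContinuum.Crystallization.Theorems

end
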